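import Summits.QuantumFields.BalabanUV.T4Continuum.Support.ShellMeasureLandauHolonomyChart

/-!
# `T4Continuum.ShellMeasureLinearChartMap` — «WALL ROW R10 IN KERNEL — THE LINEAR CHART MAP», file 1a: the three analytic binders
# of the coarse-datum map `Φ` (`hΦd`∕`hΦ0`∕`hΦ`, per scheme tuple) are FREE for a bounded complex-LINEAR chart map, from ONE
# number relation `‖T V‖·r_Φ < b`; the reality row; non-vacuity of the entering relation
(cell `pub-balaban`, sub-cell `t4`, spine estimate NE7c (node U5b); NE7c ROUND-2 crew, unit `b2b-balaban-t4-ne7c-formalise-leaf-10`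
gen 13; owner table `t4/b2b-balaban-t4-ne7c-p1/LEAVES-NE7c-P1.md` row **S104** «WALL ROW R10 IN KERNEL — THE LINEAR CHART MAP»
(own-initiative OFFER O-ne7cL10g13-1 journal l.20903, owner GO R-ne7cp1-g36-2 l.21166), file 1a of 3 — file 1b `ShellMeasureLinearChartBlock` is the DESIGNED instance (block coordinates regrouped per bond, fibre
coordinate map, pinned extension by zero), file 2 re-fires the most-assembled one-slot END (S99 f3b
`ShellMeasureLandauEndAssembledDecayCf`) with `Φ := fun V => ⇑(T V)`; ADDITIVE — imports `ShellMeasureLandauHolonomyChart` ONLY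
(for `cplx`); [folklore]; 0 `def`, 0 `def … : Prop`, 0 sorry, 0 citation tags)

HONEST FRAMING.  Finite four-torus programme, rung (B)+1 only — NOT infinite volume, NOT a mass gap, NOT the Clay problem, NOT
summit progress; (B), `BetaPertHyp`, (B^μ) not consumed.  NE7c (`T4IndicatorShell.ShellWeightBound` for the cell's expansions) is
NOT PRINTED in [Balaban 1983–89] and NOT PROVED; «NE7c ⇐ the named binders» (trigger c3).  This file is LINEAR ALGEBRA ON OUR OWN
CHART: nothing of Bałaban's is asserted, cited or discharged.  HONEST DEPENDENCY (cell): continuum YM on T⁴ ⇐ BetaPertH ∧ nine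
spine estimates (0/9 proved); BetaPertH ⇐ (D1) ∧ (D4) ∧ CAP+tail; G-an2-4 gates asym, D1 and NE2/3/4.

THE POINT (wall row R10 of the owner's census `t4/b2b-balaban-t4-ne7c-p1/ONECALL-CENSUS-NE7c.md`).  Every END-II host of record
(S76 f2 `ShellMeasureLandauEndFinal` → S80 f3∕f6 → S99 f3b, composed by THE ONE CALL S95∕S102) takes, per scheme tuple, a
coarse-datum map `Φ : GaugeField P j SU2 → (Fin m₀ → ℂ) → ℬ` with THREE analytic binders — `hΦd : ∀ V, DifferentiableOn ℂ (Φ V)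
(ball 0 rΦ)`, `hΦ0 : ∀ V, Φ V 0 = 0`, `hΦ : ∀ V, ∀ z ∈ ball 0 rΦ, ‖Φ V z‖ < b` (u-tuple `b = 2·dL·C₁·ε₁`; w-tuple `bw`; e-tuple
`be`) — nine hypotheses of printed TYPE (class [T], «W-a; node O»).  READING (a locator, NOT a citation, nothing asserted): in
[Balaban1985Variational] the letter `B` is the CONSTRAINT DATUM of the variational problem — p. 284 (42) «`Q(ηA) = B` on `𝔅_k`,
`|B| < 2dLC₁ε₁`», p. 289 (75) «`L_jηQ_jA′ = B` on `Λ_j`» — and, in the analyticity statement the END hosts mirror (Sect. G p. 305: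
«if `V = V′V₀`, `V′` small, `U₀ = U_k(V₀)`, and if we fix a gauge condition for `U_k(V′V₀)U₀⁻¹`, then it is an analytic function of
`B = (1∕i) log V′`»; (172) «`V′ = e^{iB′}`, `|B′| < 2C₁ε₁` on `𝔅_k`»; (174) «`𝓗 = 𝒜₁ + H₁B`» = the hosts' `solAt … (H₁ V (Φ V (cplx y))) +
H₁ V (Φ V (cplx y))`; Prop. 9 p. 309 «where `B = (1∕i) log V′`»), the BONDWISE LOGARITHM of the coarse field relative to the centre
`V₀`; in OUR exponential chart (`T4CubeChartExp.expFibreChart Λ c e`, coordinates `y : Fin m₀ → ℝ`, `e : ↥Λ × Fin 3 ≃ Fin m₀`,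
`x ↦ (b ↦ c_b · exp(ι x_{e(b,·)}))`) that datum is `y` ITSELF, regrouped per bond, read through the fibre's coordinate map, extended
by zero off the block: a bounded complex-LINEAR map (the owner's WALL §3 locator table: «(75)∕(44) `Φ` … elementary ONCE node O
fixes the chart (likely a linear embedding)»; the designed map is file 1b's `blockChart`∕`pinChart`).  Whether Bałaban's datum for
the block-sectioned configuration IS this map is the dictionary's sentence (`hRdict`∕`hudict`, class O) — UNCHANGED, as for every
tuple.

WHAT IS PROVED (kernel; [folklore] = bookkeeping).  FOR ANY CLM FAMILY `T V : (Fin m → ℂ) →L[ℂ] ℬ`: `hΦd_of_linear` (entire),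
`hΦ0_of_linear` (`map_zero`), **`hΦ_of_linear`** (`‖T V z‖ < b` on `ball 0 r` from `‖T V‖·r < b` — no positivity side condition),
`opNorm_mul_lt_of_le` (the relation from a V-uniform operator bound), `hΦr_of_linear` (the real-structure row for a map real on real
points; the window restriction `‖y‖ ≤ S` is idle) — EXACTLY the shapes of the END hosts' binders `hΦd hΦ0 hΦ`∕`hΦdw hΦ0w hΦbw`∕
`hΦde hΦ0e hΦbe` and `hΦr`∕`hΦrw` at `Φ := fun V => ⇑(T V)` (the block-support row `hsupp` is a support property of `T` itself,
file 1b `pinChart_supp`); NON-VACUITY `radius_relation_inhabited` — the entering relation `‖T‖·r < b` is jointly inhabited with the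
window rows `0 < S < r`, `2S ≤ r` for any `T` and any `0 < b` (crew rule G-1).
NOTHING in the countdown moves; NE7c NOT PROVED; spine PROVED 0∕9.
-/

noncomputable section

open Set Metric

namespace Summit.QuantumFields.BalabanUV.T4Continuum.ShellMeasureLinearChartMap

open ShellMeasureLandauHolonomyChart (cplx)

/-! ## §1 The R10 triple (and the reality ∕ support rows) for ANY continuous linear chart map -/

section General

variable {m : ℕ} {𝔙 ℬ : Type*} [NormedAddCommGroup ℬ] [NormedSpace ℂ ℬ]

/-- `hΦd` for a linear chart map: a continuous linear map is differentiable on every ball (on every set). [folklore] -/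
theorem hΦd_of_linear (T : 𝔙 → ((Fin m → ℂ) →L[ℂ] ℬ)) (r : ℝ) :
    ∀ V, DifferentiableOn ℂ (⇑(T V)) (ball (0 : Fin m → ℂ) r) :=
  fun V => (T V).differentiable.differentiableOn

/-- `hΦ0` for a linear chart map: `T V 0 = 0`. [folklore] -/
theorem hΦ0_of_linear (T : 𝔙 → ((Fin m → ℂ) →L[ℂ] ℬ)) : ∀ V, (T V) 0 = 0 :=
  fun V => map_zero (T V)

/-- the one-map form of `hΦ`: `‖T z‖ ≤ ‖T‖·‖z‖ ≤ ‖T‖·r < b` on `ball 0 r`. [folklore] -/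
theorem norm_apply_lt_of_opNorm_mul_lt (T : (Fin m → ℂ) →L[ℂ] ℬ) {r b : ℝ} (hTb : ‖T‖ * r < b) :
    ∀ z ∈ ball (0 : Fin m → ℂ) r, ‖T z‖ < b := fun z hz =>
  (T.le_opNorm z).trans_lt
    ((mul_le_mul_of_nonneg_left (mem_ball_zero_iff.1 hz).le (norm_nonneg _)).trans_lt hTb)

/-- **`hΦ` for a linear chart map** from ONE number relation per section: `‖T V‖·r < b ⟹ ‖T V z‖ < b` on `ball 0 r`
(no sign condition on `r` or `b` is needed in this form). [folklore] -/
theorem hΦ_of_linear (T : 𝔙 → ((Fin m → ℂ) →L[ℂ] ℬ)) {r b : ℝ} (hTb : ∀ V, ‖T V‖ * r < b) :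
    ∀ V, ∀ z ∈ ball (0 : Fin m → ℂ) r, ‖T V z‖ < b :=
  fun V => norm_apply_lt_of_opNorm_mul_lt (T V) (hTb V)

/-- a V-uniform operator bound `‖T V‖ ≤ N` and `N·r < b` give the relation. [folklore] -/
theorem opNorm_mul_lt_of_le (T : 𝔙 → ((Fin m → ℂ) →L[ℂ] ℬ)) {N r b : ℝ} (hN : ∀ V, ‖T V‖ ≤ N) (hr : 0 ≤ r)
    (hb : N * r < b) : ∀ V, ‖T V‖ * r < b :=
  fun V => (mul_le_mul_of_nonneg_right (hN V) hr).trans_lt hb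

/-- `hΦr` for a linear chart map real on real points: the window restriction `‖y‖ ≤ S` is idle. [folklore] -/
theorem hΦr_of_linear (T : 𝔙 → ((Fin m → ℂ) →L[ℂ] ℬ)) (𝓡ℬ : AddSubgroup ℬ)
    (hTr : ∀ V (y : Fin m → ℝ), T V (cplx y) ∈ 𝓡ℬ) (S : ℝ) :
    ∀ V, ∀ y : Fin m → ℝ, ‖y‖ ≤ S → T V (cplx y) ∈ 𝓡ℬ :=
  fun V y _ => hTr V y

end General

/-! ## §2 Non-vacuity (crew rule G-1 for the entering relation) -/

section NonVacuity

variable {m : ℕ} {ℬ : Type*} [NormedAddCommGroup ℬ] [NormedSpace ℂ ℬ]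

/-- **THE ENTERING NUMBER RELATION IS JOINTLY INHABITED WITH THE WINDOW ROWS**: for any map `T` and any `0 < b` there are
`0 < S < r` with `2S ≤ r` and `‖T‖·r < b` (take `r := b∕(2(‖T‖+1))`, `S := r∕2`). [folklore] -/
theorem radius_relation_inhabited (T : (Fin m → ℂ) →L[ℂ] ℬ) {b : ℝ} (hb : 0 < b) :
    ∃ S r : ℝ, 0 < S ∧ S < r ∧ 2 * S ≤ r ∧ ‖T‖ * r < b := by
  have hN : 0 < ‖T‖ + 1 := by positivity
  refine ⟨b / (2 * (‖T‖ + 1)) / 2, b / (2 * (‖T‖ + 1)), by positivity, by linarith [show 0 < b / (2 * (‖T‖ + 1)) by positivity],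
    by linarith, ?_⟩
  calc ‖T‖ * (b / (2 * (‖T‖ + 1))) ≤ (‖T‖ + 1) * (b / (2 * (‖T‖ + 1))) :=
        mul_le_mul_of_nonneg_right (by linarith) (by positivity)
    _ = b / 2 := by field_simp
    _ < b := by linarith

end NonVacuity

end Summit.QuantumFields.BalabanUV.T4Continuum.ShellMeasureLinearChartMap
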